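import Summits.ResolutionOfSingularities.ResolutionOfSingularities.Theorems.PurityValveClasses
import Summits.ResolutionOfSingularities.ResolutionOfSingularities.Theorems.AbsoluteContactInsep
import Summits.ResolutionOfSingularities.ResolutionOfSingularities.Theorems.PPowerForm
import Literature.AlgebraicGeometry.Resolution.PIndependence
import Literature.AlgebraicGeometry.Resolution.DiffOpPowerSeriesZeroSection
import Literature.AlgebraicGeometry.Resolution.DiffIdealStalk
import HarnessLib

/-!
# SubfieldContactClasses — decomp-res node «SubfieldContact» (lens-6 g19, critic rows 147/147b), tree file 1/5 of the node

Content VERBATIM from the decomp-res lens-6 g19 node file `HOME/decomp-res-lens-6/g19/SubfieldContact.lean` (rev 1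
pin ba733ec4…, 855 l;
= `parts/SubfieldContact-g19-rev1-ba733ec4.lean`; HOME = run/shared/lean/pub/decomp-res).  Critic: CRITIC-LEDGER
rows 147 (node 90f156f3 CLEARED) and 147b
(rev 1 = MAP +1, window (M2) consumed; «rev 1 ba733ec4 SUPERSEDES 90f156f3 as the source of
Theorems/SubfieldContactClasses», order 2026-08-30T22:19:25Z).
Landed by decomp-res writer g8 in the lens's namespace `…Theorems.SubfieldContactClasses`, split CONE-AWARE for
the 400-line limit: `SubfieldContactClasses`
(§1–§6), `SubfieldContactFrames` (§7), `SubfieldContactAbs` (§8–§9), `SubfieldContactPowAdjoin` (§10) are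
OUTSIDE the Theses cone (the lens's cone import
`MaxContactCutTauLadder` is used only by the «…_of_items» / «…_of_pieces» up-links from the MaxContactCut
items, which live in the in-cone wiring file
`MaxContactCutSubfieldContact`).  All `--supports stmt-ResolutionOfSingularities-29273` (`RungOne` = `E 2 → E 1`).
 Route bookkeeping (critic rows 147/147b):
ONE located-residual aside `E1NoSubDvd` (home `SubfieldContactClasses`) on 29273; the NEW LEMMA `SubfieldContactAbs`
(skeleton §9 BY NAME: stubs
`StalkSubfieldContactAbs` / `ContactSpreads` / `SubfieldContactGlue`, `PowAdjoinBase` PROVED by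
`powAdjoinBase_holds`) is booked as the prover target (kind aside
under the NAMED-RUNG RULE — outside the cone of `closes`); `SubfieldContact` is its kernel corollary
(`subfieldContact_of_abs`) and is NOT served separately.

§1 the class predicate `HasSubfieldContact`; §2 the EXACT carve of `WOR n` / `E 1` by subfield contact (`WORSub`,
`WORNoSub`, `WORNoSubDvd`, `E1Sub`,
`E1NoSub`, `E1NoSubDvd` = THE LOCATED RESIDUAL, `wor_iff_sub_noSub`, `e_one_iff_sub_noSub`); §3 closure of the
subfield-contact class BY NAME from
`SeqDimFour 5 n` / `E 5`; §4 THE NEW LEMMA `SubfieldContact` (@[conjecture] def) and `worNoSub_iff_dvd` /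
`e1NoSub_iff_dvd`; §5 the cone edge
`e_one_iff_noSubDvd (hS) (h5)`; §6 the marking-3, `p ≠ 3` column (`wor_three_off3`, `WORPureOn`,
`worPure_three_of_five_and_on3`).  The item
up-links `e1Sub_of_items`, `e_one_iff_noSubDvd_of_items`, `worPure_three_of_items_and_on3`… that quote
MaxContactCut items are in
`MaxContactCutSubfieldContact`.  PROVED except the tagged conjecture, 0 sorry.  Cone-free.

## The lens's node description (VERBATIM)

# SubfieldContact — the SUBFIELD-CONTACT CUT of weak order reduction in dimension four
(decomp-res lens-6 «barrier-complement carving», generation 19; host `E 1` = 29273 `RungOne` in sequence form;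
by restriction the lens-6 column `PVPureGame` 31574 @ marking 3, `p ≠ 3`, i.e. the asides 27751 → 27753 → 27896)

THE MOVE (one sentence).  Weak order reduction never looks at the structure map: a datum `(Y → Spec k, 𝓘, n)` may be
resolved as a datum over ANY field `F` for which `Y → Spec F` is still separated, of finite type and quasi-compact —
and over a purely inseparably SMALLER field `F ⊂ k`, `k^{p^e} ⊆ F`, `[k : F] < ∞`, the `F`-linear differential
operators of `Y` differentiate the finitely many «inseparable constants» of `k` that the residue field of a top point
needs, so that a top point WITHOUT a `k`-linear hypersurface of maximal contact (the imperfect-field pocket of the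
cell: `τ_k = 1`, class exactly 1, e.g. `(v^p - a)^3 + x(yu(v^p - a) + y^3 + u^3)` over `𝔽_p(a)`, generation 17)
BECOMES an `F`-contact point, and lens-5's exhaustion bridge — the TREE's `ExhaustionBridge`, quantified over all
fields — applies over `F` verbatim.

CONTENT (0 `sorry`, standard axioms):

* the class predicate `HasSubfieldContact p Y 𝓘 n` («some finite-type field structure `Y → Spec F` makes every point
  of order `n` an `F`-contact point», MaxContactCut's `IsContactPt` VERBATIM for the structure `f`), the EXACT carve
  `WOR n ⟺ WORSub n ∧ WORNoSub n`, `E 1 ⟺ E1Sub ∧ E1NoSub` (kernels `wor_iff_sub_noSub`, `e_one_iff_sub_noSub`);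
* CLOSURE OF THE SUBFIELD-CONTACT CLASS BY NAME (kernel `worSub_of_seqDimFour_five`, `e1Sub_of_e_five`):
  `SeqDimFour 5 n → WORSub n`, `E 5 → E1Sub` — and `E 5` is the tree's lens-5 class, closed modulo the cell port X1
  (`MaxContactCut.MarkedThreefoldResolution` 28616), the fact CJS-B and lens-5's `ExhaustionBridge`
  (tree kernel `MaxContactCutTauLadder.e_five_of_items`), so `E1Sub` is CLOSED-MOD-PORT (`e1Sub_of_items`);
* THE NEW LEMMA `SubfieldContact` (`@[conjecture]` = unproved in kernel; paper proof NODE-g19.md §3 from generation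
  18's KERNEL theorem `hasQFrames`/`exists_isDiffOpLE_of_isQFrame` + Matsumura §26 (p-bases, Cartier equality
  26.10) + EGA IV₄ 16.8 (localisation of `Diff` for morphisms of finite presentation) + openness of the regular
  locus of an excellent scheme): «`p ∤ n` ⟹ every order-`≤ n` datum on an `IsBase` scheme over ANY field of
  characteristic `p` has subfield contact».  Hence the class WITHOUT subfield contact is supported at the wild
  markings `p ∣ n` only (`worNoSub_iff_dvd`, `e1NoSub_iff_dvd`);
* THE CONE EDGE (kernels `e_one_iff_noSubDvd`, `e_one_iff_noSubDvd_of_items`): modulo `SubfieldContact` and `E 5`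
  (resp. the three booked inputs of `E 5`), `E 1 ⟺ E1NoSubDvd` — weak order reduction in dimension four over
  arbitrary fields is EXACTLY its located residual «order-`n` data with `p ∣ n` admitting no finite-type field
  structure over which all top points are contact points», which contains every catalogued wild specimen of the cell
  (purely inseparable initial forms: every operator of order `< p^m` over any base is `𝒪^{p^m}`-linear) and NO datum
  prime to `p`: the «imperfect `k`» pocket of the critic's erratum #2 is DISSOLVED at every coprime marking;
* THE LENS-6 COLUMN IS BYPASSED (kernels `wor_three_off3`, `worPure_three_of_five_and_on3`): at marking 3, `p ≠ 3`,
  weak order reduction holds for ALL data modulo `SubfieldContact` and `SeqDimFour 5 3` (= `ExhaustionBridge` at 3,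
  X1 at `3! = 6`, CJS-B); so the `p ≠ 3` half of `WORPure 3` (= 31574 @ 3, tree `pvPureGame_iff`) — the half the
  engine-side asides 27751 `AllHug3Off3` ⟸ 27752 ⟸ 27753 `HypHug3Insep` ⟸ 27896 `HypHug3InsepNoCurve` refine — is
  served WITHOUT the hugging law.  27896 is not decided here; it leaves the critical path (NODE-g19.md §6).
* THE TYPED ATTACK PLAN FOR THE NEW LEMMA (§7, the prover's skeleton): structure maps over subfields `strOver g F`,
  `k^{(q)}(Λ) = powAdjoin k q Λ`, absolute `p`-bases (`IsPBasis`, existence `exists_isPBasis` from the tree's Zorn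
  lemma), contact AT THE STALK (`IsStalkContactPt`); PIECE R «a smaller structure field has more differential
  operators, so contact descends along `F₀ ≤ F ≤ k`» PROVED in kernel (`diffIdeal_le_of_isScalarTower`,
  `diffIdealSheaf_le_comp`, `isContactPt_comp_specMap`, `isContactPt_strOver_mono`); the four remaining pieces
  `StalkSubfieldContact` (L1, THE NEW CORE: generation 18's `p^e`-frame read over `k^{(p^n)}(B ∖ S_y)`, `S_y` finite by
  Cartier's equality), `PowAdjoinBase` (F, finite codegree), `ContactSpreads` (L2, localisation of `Diff` + open
  regular locus), `SubfieldContactGlue` (C, quasi-compactness of `Top` + Jacobson + PIECE R), and the kernel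
  composition `subfieldContact_of_pieces : L1 → F → L2 → C → SubfieldContact` (0 `sorry`).

Honesty.  `HasSubfieldContact` asks for ONE field structure serving all top points at once (that is what the bridge
consumes); the pointwise statement at a closed point is generation 18 read `F`-linearly, and the passage
pointwise ⟹ global (finitely many points by quasi-compactness, all adapted constants taken inside ONE absolute
`p`-basis `B` of `k`, `F := k^{p^e}(⋂ᵢ Λᵢ)` with `⋂ᵢ Λᵢ` cofinite in `B`) is part of the paper proof (§3 (4)–(5)).
Nothing is claimed at `p ∣ n`.

References: EGAIV4 §16.8 (16.8.1, 16.8.2, 16.8.8); Matsumura1987 §26 (Thm 26.5, 26.7, 26.8, 26.10), Thm 30.6;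
Giraud1975; EncinasVillamayor2000GoodPoints §4; BierstoneGrigorievMilmanWlodarczyk2011 §3, Thm 8.0.5;
CossartJannsenSaito2020 Thm 1.4 / 6.9; CossartPiltant2008I Thm 2.1 (the hypothesis «`k` differentially finite over a
perfect `k₀`») and p. 15; Cossart2011WeakMaximalContact; CossartPiltant2019; Kollar2007 §3.9.

[WRITER NOTE (decomp-res writer g8): section split only; namespace, opens, section variables and every declaration
exactly as in the lens (global
`set_option` dropped; the cone import replaced in the cone-free files by the cone-free `WeakOrderReduction`, already
under `PurityValveClasses`).]

(Sources: EGAIV4 §16.8; Matsumura1987 §26, Thm 30.6; Giraud1975; EncinasVillamayor2000GoodPoints §4;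
BierstoneGrigorievMilmanWlodarczyk2011 §3; CossartJannsenSaito2020 Thm 1.4; CossartPiltant2008I Thm 2.1;
Cossart2011WeakMaximalContact; CossartPiltant2019; Kollar2007 §3.9.)
-/

noncomputable section

namespace Summit.ResolutionOfSingularities.ResolutionOfSingularities.Theorems.SubfieldContactClasses

open CategoryTheory AlgebraicGeometry TopologicalSpace
open Literature.AlgebraicGeometry.Resolution
open Summit.ResolutionOfSingularities.ResolutionOfSingularities.Theorems
open WeakOrderReduction ForcedTowerClasses PurityValveClasses

/-! ## §1 The class predicate: contact over SOME finite-type field structure -/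

/-- **`HasSubfieldContact p Y 𝓘 n`** — there is a field `F` of characteristic `p` and a structure map
`f : Y ⟶ Spec F`, separated, locally of finite type and quasi-compact, for which EVERY point `y` with `ord_y 𝓘 = n`
is an `F`-contact point (`IsContactPt f 𝓘 n y`: some affine `U ∋ y` carries `u ∈ Diff^{≤ n-1}_{Y/F}(𝓘)(U)` with germ
in `𝔪_y ∖ 𝔪_y²`).  For a datum over `k` the witness produced by `SubfieldContact` is `F = k^{p^e}(Λ) ⊆ k`,
`[k : F] < ∞`, `f = (Y → Spec k → Spec F)`; the predicate only records what the exhaustion bridge consumes.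
DEFINITION (support). -/
def HasSubfieldContact (p : ℕ) (Y : Scheme.{0}) (I : Y.IdealSheafData) (n : ℕ) : Prop :=
  ∃ (F : Type) (_ : Field F) (_ : CharP F p) (f : Y ⟶ Spec (.of F)),
    IsSeparated f ∧ LocallyOfFiniteType f ∧ QuasiCompact f ∧
      ∀ y : Y, idealOrder I y = ((n : ℕ) : ℕ∞) → IsContactPt f I n y

/-- The given structure is a witness: a datum all of whose top points are `k`-contact points (lens-5's class,
`ClassGE 5`) has subfield contact. [folklore] -/
theorem hasSubfieldContact_of_contact {p : ℕ} {k : Type} [Field k] [CharP k p] {Y : Scheme.{0}}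
    (g : Y ⟶ Spec (.of k)) (hB : IsBase Y g) (I : Y.IdealSheafData) (n : ℕ)
    (hc : ∀ y : Y, idealOrder I y = ((n : ℕ) : ℕ∞) → IsContactPt g I n y) : HasSubfieldContact p Y I n :=
  ⟨k, inferInstance, inferInstance, g, hB.isSeparated, hB.locallyOfFiniteType, hB.quasiCompact, hc⟩

/-! ## §2 The cut of `WOR n` and of `E 1` by subfield contact -/

/-- **`WOROn Q n`** — the tree's `WOR n` restricted to the characteristics `p` with `Q p` (slice schema).
DEFINITION (support). -/
def WOROn (Q : ℕ → Prop) (n : ℕ) : Prop :=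
  ∀ p : ℕ, p.Prime → Q p → ∀ (k : Type) [Field k] [CharP k p] (Y : Scheme.{0}) (g : Y ⟶ Spec (.of k)),
    IsBase Y g → ∀ M : MarkedIdeal Y, IsDatum n M → ∃ t : CentreSeq Y, WeakResolution t M

/-- **piece · `WORSub n`** — weak order reduction at marking `n` (dim ≤ 4, any field, any boundary) for the data
WITH subfield contact.  CLOSED by name from `SeqDimFour 5 n` (`worSub_of_seqDimFour_five`), hence modulo the cell port
X1, CJS-B and lens-5's `ExhaustionBridge`. -/
def WORSub (n : ℕ) : Prop :=
  ∀ p : ℕ, p.Prime → ∀ (k : Type) [Field k] [CharP k p] (Y : Scheme.{0}) (g : Y ⟶ Spec (.of k)),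
    IsBase Y g → ∀ M : MarkedIdeal Y, IsDatum n M → HasSubfieldContact p Y M.ideal n →
      ∃ t : CentreSeq Y, WeakResolution t M

/-- **piece · `WORNoSubOn Q n`** — weak order reduction at marking `n` for the data WITHOUT subfield contact, in the
characteristics `p` with `Q p`.  DEFINITION (support). -/
def WORNoSubOn (Q : ℕ → Prop) (n : ℕ) : Prop :=
  ∀ p : ℕ, p.Prime → Q p → ∀ (k : Type) [Field k] [CharP k p] (Y : Scheme.{0}) (g : Y ⟶ Spec (.of k)),
    IsBase Y g → ∀ M : MarkedIdeal Y, IsDatum n M → ¬ HasSubfieldContact p Y M.ideal n →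
      ∃ t : CentreSeq Y, WeakResolution t M

/-- **piece · `WORNoSub n`** — all characteristics. -/
def WORNoSub (n : ℕ) : Prop := WORNoSubOn (fun _ => True) n

/-- **THE LOCATED RESIDUAL · `WORNoSubDvd n`** — data without subfield contact at the markings divisible by the
characteristic.  Contains every catalogued wild specimen of the cell; empty prime to `p` (`SubfieldContact`). -/
def WORNoSubDvd (n : ℕ) : Prop := WORNoSubOn (· ∣ n) n

/-- The families over all markings `n ≥ 1`. -/
def E1Sub : Prop := ∀ n : ℕ, 1 ≤ n → WORSub n

/-- see `E1Sub`. -/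
def E1NoSub : Prop := ∀ n : ℕ, 1 ≤ n → WORNoSub n

/-- **THE LOCATED RESIDUAL OF `E 1`** (all markings): data without subfield contact, `p ∣ n`. -/
def E1NoSubDvd : Prop := ∀ n : ℕ, 1 ≤ n → WORNoSubDvd n

/-- `WOR n` is the slice schema at the trivial predicate. [folklore] -/
theorem wor_iff_worOn_true (n : ℕ) : WOR n ↔ WOROn (fun _ => True) n :=
  ⟨fun h p hp _ k _ _ Y g hB M hM => h p hp k Y g hB M hM, fun h p hp k _ _ Y g hB M hM => h p hp trivial k Y g hB M hM⟩

/-- Slices recombine. [folklore] -/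
theorem worOn_iff_and (Q R : ℕ → Prop) (n : ℕ) :
    WOROn (fun p => Q p ∨ R p) n ↔ WOROn Q n ∧ WOROn R n :=
  ⟨fun h => ⟨fun p hp hq => h p hp (Or.inl hq), fun p hp hr => h p hp (Or.inr hr)⟩,
    fun h p hp hqr => hqr.elim (fun hq => h.1 p hp hq) (fun hr => h.2 p hp hr)⟩

/-- Monotonicity of the residual slice schema in the predicate. [folklore] -/
theorem worNoSubOn_mono {Q R : ℕ → Prop} (hQR : ∀ p, R p → Q p) {n : ℕ} (h : WORNoSubOn Q n) :
    WORNoSubOn R n :=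
  fun p hp hr => h p hp (hQR p hr)

/-- **EXACT CARVE at one marking**: `WOR n ⟺ WORSub n ∧ WORNoSub n`. [folklore] -/
theorem wor_iff_sub_noSub (n : ℕ) : WOR n ↔ WORSub n ∧ WORNoSub n := by
  constructor
  · intro h
    exact ⟨fun p hp k _ _ Y g hB M hM _ => h p hp k Y g hB M hM,
      fun p hp _ k _ _ Y g hB M hM _ => h p hp k Y g hB M hM⟩
  · rintro ⟨hS, hN⟩ p hp k _ _ Y g hB M hM
    by_cases hsub : HasSubfieldContact p Y M.ideal n
    · exact hS p hp k Y g hB M hM hsub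
    · exact hN p hp trivial k Y g hB M hM hsub

/-- **EXACT CARVE of the family**: `E 1 ⟺ E1Sub ∧ E1NoSub`. [folklore] -/
theorem e_one_iff_sub_noSub : E 1 ↔ E1Sub ∧ E1NoSub := by
  constructor
  · intro h
    exact ⟨fun n hn => ((wor_iff_sub_noSub n).1 (wor_of_seqDimFour_one (h n hn))).1,
      fun n hn => ((wor_iff_sub_noSub n).1 (wor_of_seqDimFour_one (h n hn))).2⟩
  · rintro ⟨hS, hN⟩ n hn
    exact seqDimFour_one_of_wor ((wor_iff_sub_noSub n).2 ⟨hS n hn, hN n hn⟩)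

/-- The residual class splits by divisibility of the marking. [folklore] -/
theorem worNoSub_iff_dvd_and (n : ℕ) : WORNoSub n ↔ WORNoSubDvd n ∧ WORNoSubOn (fun p => ¬ p ∣ n) n :=
  ⟨fun h => ⟨worNoSubOn_mono (fun _ _ => trivial) h, worNoSubOn_mono (fun _ _ => trivial) h⟩,
    fun h p hp _ => (em (p ∣ n)).elim (fun hd => h.1 p hp hd) (fun hnd => h.2 p hp hnd)⟩

/-! ## §3 The subfield-contact class is lens-5's class `E 5` read over the smaller field (CLOSED BY NAME) -/

/-- **kernel · `SeqDimFour 5 n → WORSub n`**: apply weak order reduction for CONTACT data (lens-5's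
`ContactOrderSequenceDimFourAt n`, tree `seqDimFour_five_iff`) to the structure `f : Y ⟶ Spec F` of the witness —
the conclusion «`∃ t : CentreSeq Y`, weak resolution of `(𝓘, ∅, n)`» does not mention the base, and weak
resolutions ignore the boundary (`weakResolution_congr`). [folklore] -/
theorem worSub_of_seqDimFour_five {n : ℕ} (h5 : SeqDimFour 5 n) : WORSub n := by
  intro p hp k _ _ Y g hB M hM hsub
  obtain ⟨hμ, hord⟩ := hM
  obtain ⟨F, _instF, _instC, f, hs, hl, hq, hc⟩ := hsub
  obtain ⟨t, ht⟩ := h5 p hp F Y f hs hl hq hB.isRegular hB.dim_le M.ideal hord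
    (fun y hy => Or.inr (Or.inl (hc y hy)))
  exact ⟨t, (weakResolution_congr t M ⟨M.ideal, [], n⟩ rfl hμ).2 ht⟩

/-- … so `E 5 → E1Sub`. [folklore] -/
theorem e1Sub_of_e_five (h5 : E 5) : E1Sub := fun n hn => worSub_of_seqDimFour_five (h5 n hn)

/-- Conversely the subfield-contact class CONTAINS lens-5's class: `WORSub n → WOR`-for-contact-data, i.e.
`WORSub n` implies `SeqDimFour 5 n` restricted to `IsBase` data (the given structure is a witness). [folklore] -/
theorem seqDimFour_five_of_worSub {n : ℕ} (h : WORSub n) : SeqDimFour 5 n := by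
  intro p hp k _ _ Y g hs hl hq hY hdim I hord hc
  have hB : IsBase Y g := ⟨hs, hl, hq, hY, hdim⟩
  refine h p hp k Y g hB ⟨I, [], n⟩ ⟨rfl, hord⟩ (hasSubfieldContact_of_contact g hB I n fun y hy => ?_)
  rcases hc y hy with h1 | h2 | ⟨h3, -⟩
  · omega
  · exact h2
  · omega

/-- **EXACT**: `WORSub n ⟺ SeqDimFour 5 n` and `E1Sub ⟺ E 5` — the subfield-contact class IS lens-5's class
(the enlargement is invisible to the global statement because the structure map is quantified). [folklore] -/
theorem worSub_iff_seqDimFour_five (n : ℕ) : WORSub n ↔ SeqDimFour 5 n :=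
  ⟨seqDimFour_five_of_worSub, worSub_of_seqDimFour_five⟩

/-- see `worSub_iff_seqDimFour_five`. [folklore] -/
theorem e1Sub_iff_e_five : E1Sub ↔ E 5 :=
  ⟨fun h n hn => seqDimFour_five_of_worSub (h n hn), e1Sub_of_e_five⟩

/-! ## §4 THE NEW LEMMA: subfield contact is automatic prime to `p` -/

/-- **NEW LEMMA · `SubfieldContact`** [paper proof NODE-g19.md §3; kernel UNDECIDED/ATTACKABLE-L; its pointwise
stalk-level core is generation 18's KERNEL theorem `hasQFrames` + `exists_isDiffOpLE_of_isQFrame` (0 sorry)] —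
«`p` prime, `1 ≤ n`, `p ∤ n`, ANY field `k` of characteristic `p`, `Y` an `IsBase` scheme over `k`, `𝓘` with
`ord 𝓘 ≤ n` everywhere: the datum has subfield contact».  Proof (§3): fix an absolute `p`-basis `B` of `k` and
`q = p^e > n`.  (1) At a closed top point `y`, `K = κ(y)`: a subset `Λ ⊆ B` maximal `p`-independent in `K` is
COFINITE in `B` (`|B ∖ Λ| ≤ rk_K Γ_{K/k} = rk_K Ω_{K/k} < ∞`, Cartier equality, Matsumura Thm 26.10) and adapted
(`k̄ ⊆ K^p(Λ̄)`); generation 18's `p^e`-frame `𝒪_y = ⊕_γ 𝒪_y^{q}[b] u^γ` with `b ⊇ Λ` lifted by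
CONSTANTS gives an
operator `D = Δ_α`, `|α| ≤ n-1`, with `D h ∈ 𝔪_y ∖ 𝔪_y²` for `h ∈ 𝓘_y` of order `n` (`p ∤ n`), and `D` is
`𝒪_y^q[b]`-linear, hence linear over the FIELD `F_y := k^q(Λ) ⊆ 𝒪_y^q[Λ]` (`1/s = s^{q-1}/s^q`), `[k : F_y] ≤
q^{|B∖Λ|}`.  (2) `Y → Spec F_y` is of finite type, so `P^{n-1}_{Y/F_y}` is of finite presentation and `Diff_{/F_y}`
localises (EGA IV₄ 16.8.2/16.4): `D h` is, up to a unit, the germ of a section `ũ ∈ Diff^{≤ n-1}_{Y/F_y}(𝓘)(U)`.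
(3) On the open `U'' ∋ y` where `V(ũ)` is regular (excellence), EVERY point `y'` of `Top(𝓘, n) ∩ U''` is an
`F_y`-contact point via the same `ũ` (`ord_{y'} ũ ≥ n - (n-1) = 1`, and `ũ ∉ 𝔪_{y'}²` since `V(ũ)` and `Y` are
regular at `y'`).  (4) `Top(𝓘, n)` is closed in the quasi-compact Jacobson scheme `Y`: finitely many `U''_{y_i}`
cover it.  (5) `F := k^q(⋂_i Λ_i)`, `⋂_i Λ_i` cofinite in `B`, so `[k : F] < ∞`; `F ⊆ F_{y_i}`, so every
`F_{y_i}`-linear operator is `F`-linear and `ũ_i ∈ Diff^{≤ n-1}_{Y/F}(𝓘)(U''_i)`; `f := (Y → Spec k → Spec F)` is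
separated, of finite type, quasi-compact.  ∎ (Sources: Matsumura1987, §26 Thm 26.5/26.8/26.10 and Thm 30.6;
EGAIV4, 16.8.2 and 16.8.8; CossartPiltant2008I, Thm 2.1 (contrast: `k` differentially finite over a perfect `k₀`).) -/
@[conjecture]
def SubfieldContact : Prop :=
  ∀ p : ℕ, p.Prime → ∀ n : ℕ, 1 ≤ n → ¬ p ∣ n → ∀ (k : Type) [Field k] [CharP k p] (Y : Scheme.{0})
    (g : Y ⟶ Spec (.of k)), IsBase Y g → ∀ I : Y.IdealSheafData,
      (∀ y : Y, idealOrder I y ≤ ((n : ℕ) : ℕ∞)) → HasSubfieldContact p Y I n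

/-- Prime to `p` the residual class is EMPTY, so its slice of weak order reduction holds vacuously. [folklore] -/
theorem worNoSubOn_not_dvd_of_subfieldContact (hS : SubfieldContact) {n : ℕ} (hn : 1 ≤ n) :
    WORNoSubOn (fun p => ¬ p ∣ n) n := by
  intro p hp hpn k _ _ Y g hB M hM hno
  exact absurd (hS p hp n hn hpn k Y g hB M.ideal hM.2) hno

/-- **THE RESIDUAL IS LOCATED AT `p ∣ n`**: `WORNoSub n ⟺ WORNoSubDvd n` (`n ≥ 1`). [folklore] -/
theorem worNoSub_iff_dvd (hS : SubfieldContact) {n : ℕ} (hn : 1 ≤ n) : WORNoSub n ↔ WORNoSubDvd n :=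
  ⟨fun h => ((worNoSub_iff_dvd_and n).1 h).1,
    fun h => (worNoSub_iff_dvd_and n).2 ⟨h, worNoSubOn_not_dvd_of_subfieldContact hS hn⟩⟩

/-- … for the family: `E1NoSub ⟺ E1NoSubDvd`. [folklore] -/
theorem e1NoSub_iff_dvd (hS : SubfieldContact) : E1NoSub ↔ E1NoSubDvd :=
  ⟨fun h n hn => (worNoSub_iff_dvd hS hn).1 (h n hn), fun h n hn => (worNoSub_iff_dvd hS hn).2 (h n hn)⟩

/-- **COPRIME SLICES ARE LENS-5's CLASS**: for `p ∤ n`, weak order reduction of ALL order-`n` data follows from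
`SeqDimFour 5 n` (contact data) and the new lemma. [folklore] -/
theorem worOn_not_dvd_of_five (hS : SubfieldContact) {n : ℕ} (hn : 1 ≤ n) (h5 : SeqDimFour 5 n) :
    WOROn (fun p => ¬ p ∣ n) n := by
  intro p hp hpn k _ _ Y g hB M hM
  exact worSub_of_seqDimFour_five h5 p hp k Y g hB M hM (hS p hp n hn hpn k Y g hB M.ideal hM.2)

/-! ## §5 THE CONE EDGE: `E 1` is exactly its located residual, modulo the new lemma and `E 5` -/

/-- `E 1` from `E 5`, the new lemma and the located residual. [folklore] -/
theorem e_one_of_five_and_noSubDvd (hS : SubfieldContact) (h5 : E 5) (hW : E1NoSubDvd) : E 1 :=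
  e_one_iff_sub_noSub.2 ⟨e1Sub_of_e_five h5, (e1NoSub_iff_dvd hS).2 hW⟩

/-- The residual is a consequence of the host (weaker by letter). [folklore] -/
theorem e1NoSubDvd_of_e_one (h : E 1) : E1NoSubDvd :=
  fun n hn => ((worNoSub_iff_dvd_and n).1 ((e_one_iff_sub_noSub.1 h).2 n hn)).1

/-- **EXACT modulo `SubfieldContact` and `E 5`**: `E 1 ⟺ E1NoSubDvd`. [folklore] -/
theorem e_one_iff_noSubDvd (hS : SubfieldContact) (h5 : E 5) : E 1 ↔ E1NoSubDvd :=
  ⟨e1NoSubDvd_of_e_one, e_one_of_five_and_noSubDvd hS h5⟩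

/-! ## §6 The lens-6 column at marking `3`, `p ≠ 3`, is served without the hugging law -/

/-- For a prime `p`, `p ≠ 3 ⟺ ¬ p ∣ 3`. [folklore] -/
theorem prime_ne_three_iff_not_dvd {p : ℕ} (hp : p.Prime) : p ≠ 3 ↔ ¬ p ∣ 3 :=
  ⟨fun h hd => h ((Nat.prime_dvd_prime_iff_eq hp Nat.prime_three).1 hd),
    fun h he => h (he ▸ dvd_refl p)⟩

/-- **WEAK ORDER REDUCTION AT MARKING 3 OFF `p = 3`**: every order-3 datum on a regular fourfold over ANY field of
characteristic `p ≠ 3` — in particular every datum the lens-6 classes `AllHug3Off3` 27751 / `Off3Insep` /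
`HypHug3Insep` 27753 / `HypHug3InsepNoCurve` 27896 were built to serve — has a weak resolution, modulo the new lemma
and `SeqDimFour 5 3`.  The hugging law itself is NOT derived (engine side); it is bypassed. [folklore] -/
theorem wor_three_off3 (hS : SubfieldContact) (h5 : SeqDimFour 5 3) : WOROn (· ≠ 3) 3 := by
  intro p hp hp3 k _ _ Y g hB M hM
  exact worOn_not_dvd_of_five hS (by norm_num) h5 p hp ((prime_ne_three_iff_not_dvd hp).1 hp3) k Y g hB M hM

/-- **`WORPureOn Q n`** — the tree's `WORPure n` sliced by a predicate on the characteristic. DEFINITION (support). -/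
def WORPureOn (Q : ℕ → Prop) (n : ℕ) : Prop :=
  ∀ p : ℕ, p.Prime → Q p → ∀ (k : Type) [Field k] [CharP k p] (Y : Scheme.{0}) (g : Y ⟶ Spec (.of k))
    (hB : IsBase Y g), ∀ M : MarkedIdeal Y, IsDatum n M → AllCorePure p g hB.isRegular M.ideal n →
      ∃ t : CentreSeq Y, WeakResolution t M

/-- `WORPure n` recombines from complementary slices. [folklore] -/
theorem worPure_iff_on (Q : ℕ → Prop) (n : ℕ) :
    WORPure n ↔ WORPureOn Q n ∧ WORPureOn (fun p => ¬ Q p) n := by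
  constructor
  · intro h
    exact ⟨fun p hp _ k _ _ Y g hB M hM hpure => h p hp k Y g hB M hM hpure,
      fun p hp _ k _ _ Y g hB M hM hpure => h p hp k Y g hB M hM hpure⟩
  · rintro ⟨h1, h2⟩ p hp k _ _ Y g hB M hM hpure
    by_cases hq : Q p
    · exact h1 p hp hq k Y g hB M hM hpure
    · exact h2 p hp hq k Y g hB M hM hpure

/-- A `WOROn` slice gives the pure slice (drop the purity hypothesis). [folklore] -/
theorem worPureOn_of_worOn {Q : ℕ → Prop} {n : ℕ} (h : WOROn Q n) : WORPureOn Q n :=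
  fun p hp hq k _ _ Y g hB M hM _ => h p hp hq k Y g hB M hM

/-- **THE BYPASS OF THE LENS-6 COLUMN**: the `p ≠ 3` half of the host aside `PVPureGame` 31574 at its live marking 3
(`WORPure 3`, tree `MaxContactCutPurityValve.pvPureGame_iff`) — the half the asides 27751 → 27752 → 27753 → 27896
refine — from the new lemma and `SeqDimFour 5 3` ALONE. [folklore] -/
theorem worPureOn_ne_three (hS : SubfieldContact) (h5 : SeqDimFour 5 3) : WORPureOn (· ≠ 3) 3 :=
  worPureOn_of_worOn (wor_three_off3 hS h5)

/-- … so `WORPure 3` is `SeqDimFour 5 3`, the new lemma, plus its `p = 3` column only. [folklore] -/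
theorem worPure_three_of_five_and_on3 (hS : SubfieldContact) (h5 : SeqDimFour 5 3) (h3 : WORPureOn (· = 3) 3) :
    WORPure 3 :=
  (worPure_iff_on (· = 3) 3).2 ⟨h3, worPureOn_ne_three hS h5⟩

end Summit.ResolutionOfSingularities.ResolutionOfSingularities.Theorems.SubfieldContactClasses
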